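import Summits.Parity.GeneralizedHardyLittlewood.Theorems.PrimeLevelFamEdgeMomentsBeyondDiagonalDiagGenericPoly
import Summits.Parity.GeneralizedHardyLittlewood.Theorems.PrimeLevelFamEdgeMomentsBeyondDiagonalDiagDecorOrderHecke
import Summits.Parity.GeneralizedHardyLittlewood.Theorems.PrimeLevelFamEdgeMomentsBeyondDiagonalDiagDecorOrderTargetNormalize
import Summits.Parity.GeneralizedHardyLittlewood.Theorems.PrimeLevelFamEdgeMomentsBeyondDiagonalDiagOrderSelberg
import Summits.Parity.GeneralizedHardyLittlewood.Theorems.PrimeLevelFamEdgeMomentsBeyondDiagonalDiagKernelFormProfile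
import HarnessLib

/-!
# Route `PrimeLevelFamEdge`, crux K_A `MomentsBeyondDiagonal` (stmt-Parity-20007), line «petersson_layers» v4, stub `stub_diag`:
# **the GENERIC ASSEMBLY: `stub_diag : SubDiag` ⟸ the generic remainder estimates (R_ij) ALONE — the order-`(i,j)` target of
# `…DiagOrderSelberg.subDiag_of_selbergOrderAsymptotics` for EVERY `(i,j)` from (Poly_ij) (a theorem, `…DiagGenericPoly`) and (R_ij)**

Fourth brick of the generic assembly (G3′)+(G4) of the census `Cruxes/MomentsBeyondDiagonal/Lines/petersson_layers_stub_diag_g18_generic.md`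
(generic version of the per-order frames `…DiagDecorOrderZeroTwoAssembly` / `…TwoTwoAssembly` / `…FourFourAssembly` and of
`…DiagOrderFourFourOfR44`):

* `selbergOrder_split` — the exact split of the order-`(i,j)` Selberg form after the Hecke summation
  (`…DiagDecorOrderHecke.selbergOrder_hecke_eq i j`) into its POLYNOMIAL PART (each Bose coefficient `c_{ab}(y)` replaced by
  `E_{ab} + Σ_{i′,j′} C(a,i′)C(b,j′)((−1)^{j′}+(−1)^{i′})μ_{i′+j′}(−1/2)^N L^{N+1}/(N+1)`, `L = log(Q²/(g²k₁k₂)) = 2λlog M − 2log g − log k₁ − log k₂`)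
  and its REMAINDER PART (`c_{ab}(y)` minus that polynomial), for ANY constants `E, μ`;
* `orderTarget_of_genericRemainder` — **for EVERY `(i,j)`: (R_ij) ⟹ the order-`(i,j)` target** with SOME level-free `K₀`
  (`τ_{ij} = Δ′²K₀/(2(π²/6)²)`; (Poly_ij) = `…DiagGenericPoly.selbergAsymp_orderPoly`, normalisation
  `…DiagDecorOrderTargetNormalize.orderTarget_of_selbergAsymptotic`), where
  (R_ij) `∃ E μ, ∀ P admissible, ∀ Δ′ ∈ (1,Δ], ∃ C q₀, ∀ q ≥ q₀: |Sel_q(rem_ij)| ≤ C·ℓ^{i+j}/ℓ³` (`ℓ = log q̂`);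
* `subDiag_of_genericRemainder` — **`SubDiag` (the registered stub `stub_diag`, by `subDiag_of_selbergOrderAsymptotics`) from the
  family of generic remainder estimates `(R_ij)`, `(i,j) ≠ (0,0)`, `i + j` even, on a window `(1,Δ]`, `1 < Δ ≤ 3/2`** — the functional
  `τ` is obtained by choice from the per-order constants (`τ₀₀ = secondMomentForm/2`); no closed forms are needed.

EXACT REMAINING LIST for `stub_diag` after this file: the generic remainder estimate (R_ij) for every `(i,j)` (inputs all generic in the
tree: `…DiagRemBoseTwoSeq.abs_doubleSum_bose_rem_le₂ a b`, `…DiagRemMomentsParam`, `…DiagRemMomentTailBoundPow` («DRTAIL»_r),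
`…DiagRemFourFourInnerSelberg.selbergRem_inner_eq_weight`, `…DiagRemOuterPow`). Def-free; theorems only. Helper `--supports stmt-Parity-20007`;
closes nothing; K_A, K_B and the Parity summit are NOT proved; nothing about Landau–Siegel zeros.

## References
* E. Kowalski, P. Michel, J. VanderKam, J. reine angew. Math. 526 (2000), (23)–(28) pp. 13–15 and Prop. 5.1 p. 18.
  [cite: KowalskiMichelVanderKam2000, (23)–(28) — derivation (diagonal main term of every order, general Q)]
-/

noncomputable section

open scoped Real ArithmeticFunction.Moebius
open Finset ArithmeticFunction Polynomial MeasureTheory Set intervalIntegral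

namespace Summit.Parity.GeneralizedHardyLittlewood.Theorems.MomentsBeyondDiagonal.DiagKernel

open Literature.NumberTheory.LFunctions Literature.NumberTheory.LFunctions.KMV2000
open Summit.Parity.GeneralizedHardyLittlewood.Theorems.PrimeLevelFamEdgeIdeaDeltas.PeterssonLayers (SubDiag)
open Summit.Parity.GeneralizedHardyLittlewood.Theorems.MomentsBeyondDiagonal.DiagLines (subDiag_of_selbergOrderAsymptotics)

set_option maxHeartbeats 1600000 in
/-- **The exact split of the order-`(i,j)` form after the Hecke summation into polynomial part and remainder part** (any constants
`E, μ`; `log Q = λ·log M`). [cite: KowalskiMichelVanderKam2000, (23)–(28) — derivation] -/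
theorem selbergOrder_split (i j : ℕ) (P : ℝ[X]) (M : ℝ) {Q lam : ℝ} (hlam : Real.log Q = lam * Real.log M)
    (E : ℕ → ℕ → ℝ) (mu : ℕ → ℝ) :
    ∑ c ∈ Icc 1 ⌊M⌋₊, ∑ g ∈ Icc 1 (⌊M⌋₊ / c), (μ g : ℝ) * c *
          ∑ k₁ ∈ Icc 1 (⌊M⌋₊ / (c * g)), ∑ k₂ ∈ Icc 1 (⌊M⌋₊ / (c * g)),
            ((μ (c * g * k₁) : ℝ) * ((psi (c * g * k₁))⁻¹ *
                P.eval (Real.log (M / ((c * g * k₁ : ℕ) : ℝ)) / Real.log M))) / ((c * g * k₁ : ℕ) : ℝ) *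
              (((μ (c * g * k₂) : ℝ) * ((psi (c * g * k₂))⁻¹ *
                P.eval (Real.log (M / ((c * g * k₂ : ℕ) : ℝ)) / Real.log M))) / ((c * g * k₂ : ℕ) : ℝ)) *
              (∑ a ∈ range (i + 1), ∑ b ∈ range (j + 1),
                (i.choose a : ℝ) * (j.choose b) *
                ((1 / 2) ^ (i - a + (j - b)) * ∑ r ∈ range (i - a + 1), ∑ s ∈ range (j - b + 1),
                  ((i - a).choose r : ℝ) * ((j - b).choose s) * (-1) ^ s *
                      (2 * (Real.log (Q) - Real.log g) - Real.log k₁ - Real.log k₂) ^ (i - a - r + (j - b - s)) *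
                    ∑ t ∈ range (r + s + 1), ((r + s).choose t : ℝ) *
                      ((∑ d ∈ k₁.divisors, (2 * Real.log d - Real.log k₁) ^ t) *
                        ∑ e ∈ k₂.divisors, (2 * Real.log e - Real.log k₂) ^ (r + s - t))) *
                (∫ u₁ in Ioi (0 : ℝ), Real.log u₁ ^ a *
                  ∫ u₂ in Ioi ((((g * g * (k₁ * k₂) : ℕ) : ℝ) / Q ^ 2) / u₁),
                    Real.exp (-(u₁ + u₂)) / (1 - Real.exp (-(u₁ + u₂))) ^ 2 * Real.log u₂ ^ b)) =
      ∑ c ∈ Icc 1 ⌊M⌋₊, ∑ g ∈ Icc 1 (⌊M⌋₊ / c), (μ g : ℝ) * c *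
          ∑ k₁ ∈ Icc 1 (⌊M⌋₊ / (c * g)), ∑ k₂ ∈ Icc 1 (⌊M⌋₊ / (c * g)),
            ((μ (c * g * k₁) : ℝ) * ((psi (c * g * k₁))⁻¹ *
                P.eval (Real.log (M / ((c * g * k₁ : ℕ) : ℝ)) / Real.log M))) / ((c * g * k₁ : ℕ) : ℝ) *
              (((μ (c * g * k₂) : ℝ) * ((psi (c * g * k₂))⁻¹ *
                P.eval (Real.log (M / ((c * g * k₂ : ℕ) : ℝ)) / Real.log M))) / ((c * g * k₂ : ℕ) : ℝ)) *
              (∑ a ∈ range (i + 1), ∑ b ∈ range (j + 1),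
                (i.choose a : ℝ) * (j.choose b) *
                ((1 / 2) ^ (i - a + (j - b)) * ∑ r ∈ range (i - a + 1), ∑ s ∈ range (j - b + 1),
                  ((i - a).choose r : ℝ) * ((j - b).choose s) * (-1) ^ s *
                      (2 * (lam * Real.log M) - 2 * Real.log g - Real.log k₁ - Real.log k₂) ^ (i - a - r + (j - b - s)) *
                    ∑ t ∈ range (r + s + 1), ((r + s).choose t : ℝ) *
                      ((∑ d ∈ k₁.divisors, (2 * Real.log d - Real.log k₁) ^ t) *
                        ∑ e ∈ k₂.divisors, (2 * Real.log e - Real.log k₂) ^ (r + s - t))) *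
                (E a b + (∑ i' ∈ Finset.range (a + 1), ∑ j' ∈ Finset.range (b + 1),
                  ((a).choose i' : ℝ) * ((b).choose j' : ℝ) * ((-1) ^ j' + (-1) ^ i') * mu (i' + j') *
                    ((-1 / 2 : ℝ) ^ (a - i' + (b - j')) * (2 * (lam * Real.log M) - 2 * Real.log g - Real.log k₁ - Real.log k₂) ^ (a - i' + (b - j') + 1) /
                      (((a - i' + (b - j') : ℕ) : ℝ) + 1))))) +
      ∑ c ∈ Icc 1 ⌊M⌋₊, ∑ g ∈ Icc 1 (⌊M⌋₊ / c), (μ g : ℝ) * c *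
          ∑ k₁ ∈ Icc 1 (⌊M⌋₊ / (c * g)), ∑ k₂ ∈ Icc 1 (⌊M⌋₊ / (c * g)),
            ((μ (c * g * k₁) : ℝ) * ((psi (c * g * k₁))⁻¹ *
                P.eval (Real.log (M / ((c * g * k₁ : ℕ) : ℝ)) / Real.log M))) / ((c * g * k₁ : ℕ) : ℝ) *
              (((μ (c * g * k₂) : ℝ) * ((psi (c * g * k₂))⁻¹ *
                P.eval (Real.log (M / ((c * g * k₂ : ℕ) : ℝ)) / Real.log M))) / ((c * g * k₂ : ℕ) : ℝ)) *
              (∑ a ∈ range (i + 1), ∑ b ∈ range (j + 1),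
                (i.choose a : ℝ) * (j.choose b) *
                ((1 / 2) ^ (i - a + (j - b)) * ∑ r ∈ range (i - a + 1), ∑ s ∈ range (j - b + 1),
                  ((i - a).choose r : ℝ) * ((j - b).choose s) * (-1) ^ s *
                      (2 * (Real.log (Q) - Real.log g) - Real.log k₁ - Real.log k₂) ^ (i - a - r + (j - b - s)) *
                    ∑ t ∈ range (r + s + 1), ((r + s).choose t : ℝ) *
                      ((∑ d ∈ k₁.divisors, (2 * Real.log d - Real.log k₁) ^ t) *
                        ∑ e ∈ k₂.divisors, (2 * Real.log e - Real.log k₂) ^ (r + s - t))) *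
                ((∫ u₁ in Ioi (0 : ℝ), Real.log u₁ ^ a *
                  ∫ u₂ in Ioi ((((g * g * (k₁ * k₂) : ℕ) : ℝ) / Q ^ 2) / u₁),
                    Real.exp (-(u₁ + u₂)) / (1 - Real.exp (-(u₁ + u₂))) ^ 2 * Real.log u₂ ^ b) -
                  (E a b + (∑ i' ∈ Finset.range (a + 1), ∑ j' ∈ Finset.range (b + 1),
                  ((a).choose i' : ℝ) * ((b).choose j' : ℝ) * ((-1) ^ j' + (-1) ^ i') * mu (i' + j') *
                    ((-1 / 2 : ℝ) ^ (a - i' + (b - j')) * (2 * (Real.log (Q) - Real.log g) - Real.log k₁ - Real.log k₂) ^ (a - i' + (b - j') + 1) /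
                      (((a - i' + (b - j') : ℕ) : ℝ) + 1)))))) := by
  refine Eq.trans (selbergForm_congr_squarefree P M ⌊M⌋₊
    (fun c g k₁ k₂ ↦ ∑ a ∈ range (i + 1), ∑ b ∈ range (j + 1),
                (i.choose a : ℝ) * (j.choose b) *
                ((1 / 2) ^ (i - a + (j - b)) * ∑ r ∈ range (i - a + 1), ∑ s ∈ range (j - b + 1),
                  ((i - a).choose r : ℝ) * ((j - b).choose s) * (-1) ^ s *
                      (2 * (Real.log (Q) - Real.log g) - Real.log k₁ - Real.log k₂) ^ (i - a - r + (j - b - s)) *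
                    ∑ t ∈ range (r + s + 1), ((r + s).choose t : ℝ) *
                      ((∑ d ∈ k₁.divisors, (2 * Real.log d - Real.log k₁) ^ t) *
                        ∑ e ∈ k₂.divisors, (2 * Real.log e - Real.log k₂) ^ (r + s - t))) *
                (∫ u₁ in Ioi (0 : ℝ), Real.log u₁ ^ a *
                  ∫ u₂ in Ioi ((((g * g * (k₁ * k₂) : ℕ) : ℝ) / Q ^ 2) / u₁),
                    Real.exp (-(u₁ + u₂)) / (1 - Real.exp (-(u₁ + u₂))) ^ 2 * Real.log u₂ ^ b))
    (fun c g k₁ k₂ ↦ (∑ a ∈ range (i + 1), ∑ b ∈ range (j + 1),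
                (i.choose a : ℝ) * (j.choose b) *
                ((1 / 2) ^ (i - a + (j - b)) * ∑ r ∈ range (i - a + 1), ∑ s ∈ range (j - b + 1),
                  ((i - a).choose r : ℝ) * ((j - b).choose s) * (-1) ^ s *
                      (2 * (lam * Real.log M) - 2 * Real.log g - Real.log k₁ - Real.log k₂) ^ (i - a - r + (j - b - s)) *
                    ∑ t ∈ range (r + s + 1), ((r + s).choose t : ℝ) *
                      ((∑ d ∈ k₁.divisors, (2 * Real.log d - Real.log k₁) ^ t) *
                        ∑ e ∈ k₂.divisors, (2 * Real.log e - Real.log k₂) ^ (r + s - t))) *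
                (E a b + (∑ i' ∈ Finset.range (a + 1), ∑ j' ∈ Finset.range (b + 1),
                  ((a).choose i' : ℝ) * ((b).choose j' : ℝ) * ((-1) ^ j' + (-1) ^ i') * mu (i' + j') *
                    ((-1 / 2 : ℝ) ^ (a - i' + (b - j')) * (2 * (lam * Real.log M) - 2 * Real.log g - Real.log k₁ - Real.log k₂) ^ (a - i' + (b - j') + 1) /
                      (((a - i' + (b - j') : ℕ) : ℝ) + 1))))) +
      (∑ a ∈ range (i + 1), ∑ b ∈ range (j + 1),
                (i.choose a : ℝ) * (j.choose b) *
                ((1 / 2) ^ (i - a + (j - b)) * ∑ r ∈ range (i - a + 1), ∑ s ∈ range (j - b + 1),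
                  ((i - a).choose r : ℝ) * ((j - b).choose s) * (-1) ^ s *
                      (2 * (Real.log (Q) - Real.log g) - Real.log k₁ - Real.log k₂) ^ (i - a - r + (j - b - s)) *
                    ∑ t ∈ range (r + s + 1), ((r + s).choose t : ℝ) *
                      ((∑ d ∈ k₁.divisors, (2 * Real.log d - Real.log k₁) ^ t) *
                        ∑ e ∈ k₂.divisors, (2 * Real.log e - Real.log k₂) ^ (r + s - t))) *
                ((∫ u₁ in Ioi (0 : ℝ), Real.log u₁ ^ a *
                  ∫ u₂ in Ioi ((((g * g * (k₁ * k₂) : ℕ) : ℝ) / Q ^ 2) / u₁),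
                    Real.exp (-(u₁ + u₂)) / (1 - Real.exp (-(u₁ + u₂))) ^ 2 * Real.log u₂ ^ b) -
                  (E a b + (∑ i' ∈ Finset.range (a + 1), ∑ j' ∈ Finset.range (b + 1),
                  ((a).choose i' : ℝ) * ((b).choose j' : ℝ) * ((-1) ^ j' + (-1) ^ i') * mu (i' + j') *
                    ((-1 / 2 : ℝ) ^ (a - i' + (b - j')) * (2 * (Real.log (Q) - Real.log g) - Real.log k₁ - Real.log k₂) ^ (a - i' + (b - j') + 1) /
                      (((a - i' + (b - j') : ℕ) : ℝ) + 1))))))) fun c g k₁ k₂ _ _ ↦ ?_)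
    (selbergProd_add P M _ _)
  have hL : (2 * (Real.log Q - Real.log g) - Real.log k₁ - Real.log k₂) =
      (2 * (lam * Real.log M) - 2 * Real.log g - Real.log k₁ - Real.log k₂) := by
    rw [hlam]; ring
  rw [← hL, ← Finset.sum_add_distrib]
  refine Finset.sum_congr rfl fun a _ ↦ ?_
  rw [← Finset.sum_add_distrib]
  refine Finset.sum_congr rfl fun b _ ↦ ?_
  ring

set_option maxHeartbeats 3200000 in
/-- **The order-`(i,j)` target from the generic remainder estimate (R_ij) alone**, for EVERY `(i,j)` (window `(1,Δ]`, any `Δ`):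
the polynomial side is the theorem `…DiagGenericPoly.selbergAsymp_orderPoly`; the level-free constant `K₀` exists (no closed form).
[cite: KowalskiMichelVanderKam2000, (23)–(28) and Prop. 5.1 — derivation (order-(i,j) piece of the diagonal main term, general Q)] -/
theorem orderTarget_of_genericRemainder (i j : ℕ) {Δ : ℝ}
    (hR : ∃ (E : ℕ → ℕ → ℝ) (mu : ℕ → ℝ), ∀ P : ℝ[X], KMV2000.Admissible P → ∀ Δ' : ℝ, 1 < Δ' → Δ' ≤ Δ →
      ∃ C : ℝ, ∃ q₀ : ℕ, ∀ (q : ℕ) [NeZero q], q₀ ≤ q →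
        |∑ c ∈ Icc 1 ⌊qhat q ^ Δ'⌋₊, ∑ g ∈ Icc 1 (⌊qhat q ^ Δ'⌋₊ / c), (μ g : ℝ) * c *
          ∑ k₁ ∈ Icc 1 (⌊qhat q ^ Δ'⌋₊ / (c * g)), ∑ k₂ ∈ Icc 1 (⌊qhat q ^ Δ'⌋₊ / (c * g)),
            ((μ (c * g * k₁) : ℝ) * ((psi (c * g * k₁))⁻¹ *
                P.eval (Real.log (qhat q ^ Δ' / ((c * g * k₁ : ℕ) : ℝ)) / Real.log (qhat q ^ Δ')))) / ((c * g * k₁ : ℕ) : ℝ) *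
              (((μ (c * g * k₂) : ℝ) * ((psi (c * g * k₂))⁻¹ *
                P.eval (Real.log (qhat q ^ Δ' / ((c * g * k₂ : ℕ) : ℝ)) / Real.log (qhat q ^ Δ')))) / ((c * g * k₂ : ℕ) : ℝ)) *
              (∑ a ∈ range (i + 1), ∑ b ∈ range (j + 1),
                (i.choose a : ℝ) * (j.choose b) *
                ((1 / 2) ^ (i - a + (j - b)) * ∑ r ∈ range (i - a + 1), ∑ s ∈ range (j - b + 1),
                  ((i - a).choose r : ℝ) * ((j - b).choose s) * (-1) ^ s *
                      (2 * (Real.log (qhat q) - Real.log g) - Real.log k₁ - Real.log k₂) ^ (i - a - r + (j - b - s)) *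
                    ∑ t ∈ range (r + s + 1), ((r + s).choose t : ℝ) *
                      ((∑ d ∈ k₁.divisors, (2 * Real.log d - Real.log k₁) ^ t) *
                        ∑ e ∈ k₂.divisors, (2 * Real.log e - Real.log k₂) ^ (r + s - t))) *
                ((∫ u₁ in Ioi (0 : ℝ), Real.log u₁ ^ a *
                  ∫ u₂ in Ioi ((((g * g * (k₁ * k₂) : ℕ) : ℝ) / qhat q ^ 2) / u₁),
                    Real.exp (-(u₁ + u₂)) / (1 - Real.exp (-(u₁ + u₂))) ^ 2 * Real.log u₂ ^ b) -
                  (E a b + (∑ i' ∈ Finset.range (a + 1), ∑ j' ∈ Finset.range (b + 1),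
                  ((a).choose i' : ℝ) * ((b).choose j' : ℝ) * ((-1) ^ j' + (-1) ^ i') * mu (i' + j') *
                    ((-1 / 2 : ℝ) ^ (a - i' + (b - j')) * (2 * (Real.log (qhat q) - Real.log g) - Real.log k₁ - Real.log k₂) ^ (a - i' + (b - j') + 1) /
                      (((a - i' + (b - j') : ℕ) : ℝ) + 1))))))| ≤
          C * Real.log (qhat q) ^ (i + j) / Real.log (qhat q) ^ 3) :
    ∀ P : ℝ[X], KMV2000.Admissible P → ∀ Δ' : ℝ, 1 < Δ' → Δ' ≤ Δ → ∃ K₀ : ℝ,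
      ∃ C : ℝ, ∃ q₀ : ℕ, ∀ (q : ℕ) [NeZero q], q₀ ≤ q →
        |(Real.log (qhat q))⁻¹ ^ (i + j) * qhat q *
          (∑ c ∈ Icc 1 ⌊qhat q ^ Δ'⌋₊, ∑ g ∈ Icc 1 (⌊qhat q ^ Δ'⌋₊ / c), (μ g : ℝ) * c *
          ∑ k₁ ∈ Icc 1 (⌊qhat q ^ Δ'⌋₊ / (c * g)), ∑ k₂ ∈ Icc 1 (⌊qhat q ^ Δ'⌋₊ / (c * g)),
            ((μ (c * g * k₁) : ℝ) * ((psi (c * g * k₁))⁻¹ *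
                P.eval (Real.log (qhat q ^ Δ' / ((c * g * k₁ : ℕ) : ℝ)) / Real.log (qhat q ^ Δ')))) / ((c * g * k₁ : ℕ) : ℝ) *
              (((μ (c * g * k₂) : ℝ) * ((psi (c * g * k₂))⁻¹ *
                P.eval (Real.log (qhat q ^ Δ' / ((c * g * k₂ : ℕ) : ℝ)) / Real.log (qhat q ^ Δ')))) / ((c * g * k₂ : ℕ) : ℝ)) *
              (∑ d ∈ k₁.divisors, ∑ e ∈ k₂.divisors,
                ∫ u₁ in Ioi (0 : ℝ),
                  (Real.log (qhat q / ((k₁ / d * (g * e) : ℕ) : ℝ)) + Real.log u₁) ^ i *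
                  ∫ u₂ in Ioi ((((k₁ / d * (g * e) * (g * d * (k₂ / e)) : ℕ) : ℝ) / qhat q ^ 2) / u₁),
                    Real.exp (-(u₁ + u₂)) / (1 - Real.exp (-(u₁ + u₂))) ^ 2 *
                    (Real.log (qhat q / ((g * d * (k₂ / e) : ℕ) : ℝ)) + Real.log u₂) ^ j)) -
          2 * (π ^ 2 / 6) ^ 2 * (qhat q / (Δ' ^ 2 * Real.log (qhat q) ^ 2)) * (Δ' ^ 2 * K₀ / (2 * (π ^ 2 / 6) ^ 2))| ≤
          C * qhat q * (Real.log (qhat q))⁻¹ ^ 3 := by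
  obtain ⟨E, mu, hR⟩ := hR
  intro P hP Δ' h1 h2
  obtain ⟨hP0, hP1⟩ := coeff_zero_one_of_admissible hP
  have hΔ0 : 0 < Δ' := by linarith
  have hlam0 : (0 : ℝ) ≤ 1 / Δ' := by positivity
  have hlam1 : 1 / Δ' ≤ 1 := (div_le_one hΔ0).2 h1.le
  obtain ⟨C_R, q_R, hRq⟩ := hR P hP Δ' h1 h2
  obtain ⟨K, C_P, hpoly⟩ := selbergAsymp_orderPoly P i j hP0 hP1 hlam0 hlam1 E mu
  obtain ⟨q₃, hq₃⟩ := exists_log_qhat_ge (2 : ℝ)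
  refine ⟨K * Δ' ^ (i + j) / Δ' ^ 2, ?_⟩
  refine orderTarget_of_selbergAsymptotic i j _ _ hΔ0.ne' ⟨C_P * Δ' ^ (i + j) / Δ' ^ 3 + C_R, max q_R q₃, fun q _ hq ↦ ?_⟩
  have hqR : q_R ≤ q := le_trans (le_max_left _ _) hq
  have hl2 : (2 : ℝ) ≤ Real.log (qhat q) := hq₃ q (le_trans (le_max_right _ _) hq)
  have hQ0 : 0 ≤ qhat q := by unfold qhat; positivity
  have hQ : 0 < qhat q := lt_of_le_of_ne hQ0 fun h0 ↦ by
    rw [← h0, Real.log_zero] at hl2; linarith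
  have hq3 : (3 : ℝ) ≤ qhat q := by
    have := Real.add_one_le_exp (Real.log (qhat q))
    rw [Real.exp_log hQ] at this
    linarith
  have hQ1 : 1 ≤ qhat q := by linarith
  have hM3 : 3 ≤ qhat q ^ Δ' := hq3.trans (Real.self_le_rpow_of_one_le hQ1 h1.le)
  have hlogM : Real.log (qhat q ^ Δ') = Δ' * Real.log (qhat q) := Real.log_rpow hQ Δ'
  have hℓpos : 0 < Real.log (qhat q) := by linarith
  have hlam : Real.log (qhat q) = 1 / Δ' * Real.log (qhat q ^ Δ') := by rw [hlogM]; field_simp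
  -- exact Hecke form and split
  rw [selbergOrder_hecke_eq i j P (qhat q ^ Δ') ⌊qhat q ^ Δ'⌋₊ hQ, selbergOrder_split i j P (qhat q ^ Δ') hlam E mu]
  have hp := hpoly (qhat q ^ Δ') hM3
  have hr := hRq q hqR
  have key : ∀ {A B X c₁ c₂ : ℝ}, |A - X| ≤ c₁ → |B| ≤ c₂ → |A + B - X| ≤ c₁ + c₂ := by
    intro A B X c₁ c₂ hA hB
    calc |A + B - X| = |(A - X) + B| := by ring_nf
      _ ≤ |A - X| + |B| := abs_add_le _ _
      _ ≤ c₁ + c₂ := add_le_add hA hB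
  have hΔ' : Δ' ≠ 0 := hΔ0.ne'
  have hℓ0 : Real.log (qhat q) ≠ 0 := hℓpos.ne'
  have eA : K * Real.log (qhat q ^ Δ') ^ (i + j) / Real.log (qhat q ^ Δ') ^ 2 =
      K * Δ' ^ (i + j) / Δ' ^ 2 * Real.log (qhat q) ^ (i + j) / Real.log (qhat q) ^ 2 := by
    rw [hlogM, mul_pow, mul_pow]
    field_simp
  have eB : C_P * Real.log (qhat q ^ Δ') ^ (i + j) / Real.log (qhat q ^ Δ') ^ 3 +
        C_R * Real.log (qhat q) ^ (i + j) / Real.log (qhat q) ^ 3 =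
      (C_P * Δ' ^ (i + j) / Δ' ^ 3 + C_R) * Real.log (qhat q) ^ (i + j) / Real.log (qhat q) ^ 3 := by
    rw [hlogM, mul_pow, mul_pow]
    field_simp
  have h' := key hp hr
  rw [eA, eB] at h'
  exact h'

set_option maxHeartbeats 3200000 in
/-- **`SubDiag` FROM THE GENERIC REMAINDER ESTIMATES (R_ij) ALONE** (orders `(i,j) ≠ (0,0)` with `i + j` even; window `(1,Δ]`,
`1 < Δ ≤ 3/2`): the functional `τ` of `…DiagOrderSelberg.subDiag_of_selbergOrderAsymptotics` is chosen from the per-order constants of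
`orderTarget_of_genericRemainder` (`τ₀₀ = secondMomentForm/2`). [cite: KowalskiMichelVanderKam2000, (23)–(28) and Prop. 5.1 — derivation (diagonal main term, general Q)] -/
theorem subDiag_of_genericRemainder {Δ : ℝ} (hΔ1 : 1 < Δ) (hΔ : Δ ≤ 3 / 2)
    (hR : ∀ i j : ℕ, Even (i + j) → ¬(i = 0 ∧ j = 0) →
      ∃ (E : ℕ → ℕ → ℝ) (mu : ℕ → ℝ), ∀ P : ℝ[X], KMV2000.Admissible P → ∀ Δ' : ℝ, 1 < Δ' → Δ' ≤ Δ →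
      ∃ C : ℝ, ∃ q₀ : ℕ, ∀ (q : ℕ) [NeZero q], q₀ ≤ q →
        |∑ c ∈ Icc 1 ⌊qhat q ^ Δ'⌋₊, ∑ g ∈ Icc 1 (⌊qhat q ^ Δ'⌋₊ / c), (μ g : ℝ) * c *
          ∑ k₁ ∈ Icc 1 (⌊qhat q ^ Δ'⌋₊ / (c * g)), ∑ k₂ ∈ Icc 1 (⌊qhat q ^ Δ'⌋₊ / (c * g)),
            ((μ (c * g * k₁) : ℝ) * ((psi (c * g * k₁))⁻¹ *
                P.eval (Real.log (qhat q ^ Δ' / ((c * g * k₁ : ℕ) : ℝ)) / Real.log (qhat q ^ Δ')))) / ((c * g * k₁ : ℕ) : ℝ) *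
              (((μ (c * g * k₂) : ℝ) * ((psi (c * g * k₂))⁻¹ *
                P.eval (Real.log (qhat q ^ Δ' / ((c * g * k₂ : ℕ) : ℝ)) / Real.log (qhat q ^ Δ')))) / ((c * g * k₂ : ℕ) : ℝ)) *
              (∑ a ∈ range (i + 1), ∑ b ∈ range (j + 1),
                (i.choose a : ℝ) * (j.choose b) *
                ((1 / 2) ^ (i - a + (j - b)) * ∑ r ∈ range (i - a + 1), ∑ s ∈ range (j - b + 1),
                  ((i - a).choose r : ℝ) * ((j - b).choose s) * (-1) ^ s *
                      (2 * (Real.log (qhat q) - Real.log g) - Real.log k₁ - Real.log k₂) ^ (i - a - r + (j - b - s)) *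
                    ∑ t ∈ range (r + s + 1), ((r + s).choose t : ℝ) *
                      ((∑ d ∈ k₁.divisors, (2 * Real.log d - Real.log k₁) ^ t) *
                        ∑ e ∈ k₂.divisors, (2 * Real.log e - Real.log k₂) ^ (r + s - t))) *
                ((∫ u₁ in Ioi (0 : ℝ), Real.log u₁ ^ a *
                  ∫ u₂ in Ioi ((((g * g * (k₁ * k₂) : ℕ) : ℝ) / qhat q ^ 2) / u₁),
                    Real.exp (-(u₁ + u₂)) / (1 - Real.exp (-(u₁ + u₂))) ^ 2 * Real.log u₂ ^ b) -
                  (E a b + (∑ i' ∈ Finset.range (a + 1), ∑ j' ∈ Finset.range (b + 1),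
                  ((a).choose i' : ℝ) * ((b).choose j' : ℝ) * ((-1) ^ j' + (-1) ^ i') * mu (i' + j') *
                    ((-1 / 2 : ℝ) ^ (a - i' + (b - j')) * (2 * (Real.log (qhat q) - Real.log g) - Real.log k₁ - Real.log k₂) ^ (a - i' + (b - j') + 1) /
                      (((a - i' + (b - j') : ℕ) : ℝ) + 1))))))| ≤
          C * Real.log (qhat q) ^ (i + j) / Real.log (qhat q) ^ 3) :
    SubDiag := by
  classical
  -- per-order constants by choice
  have hT : ∀ i j : ℕ, Even (i + j) → ¬(i = 0 ∧ j = 0) → ∀ P : ℝ[X], KMV2000.Admissible P → ∀ Δ' : ℝ, 1 < Δ' → Δ' ≤ Δ →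
      ∃ K₀ : ℝ, ∃ C : ℝ, ∃ q₀ : ℕ, ∀ (q : ℕ) [NeZero q], q₀ ≤ q →
        |(Real.log (qhat q))⁻¹ ^ (i + j) * qhat q *
          (∑ c ∈ Icc 1 ⌊qhat q ^ Δ'⌋₊, ∑ g ∈ Icc 1 (⌊qhat q ^ Δ'⌋₊ / c), (μ g : ℝ) * c *
          ∑ k₁ ∈ Icc 1 (⌊qhat q ^ Δ'⌋₊ / (c * g)), ∑ k₂ ∈ Icc 1 (⌊qhat q ^ Δ'⌋₊ / (c * g)),
            ((μ (c * g * k₁) : ℝ) * ((psi (c * g * k₁))⁻¹ *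
                P.eval (Real.log (qhat q ^ Δ' / ((c * g * k₁ : ℕ) : ℝ)) / Real.log (qhat q ^ Δ')))) / ((c * g * k₁ : ℕ) : ℝ) *
              (((μ (c * g * k₂) : ℝ) * ((psi (c * g * k₂))⁻¹ *
                P.eval (Real.log (qhat q ^ Δ' / ((c * g * k₂ : ℕ) : ℝ)) / Real.log (qhat q ^ Δ')))) / ((c * g * k₂ : ℕ) : ℝ)) *
              (∑ d ∈ k₁.divisors, ∑ e ∈ k₂.divisors,
                ∫ u₁ in Ioi (0 : ℝ),
                  (Real.log (qhat q / ((k₁ / d * (g * e) : ℕ) : ℝ)) + Real.log u₁) ^ i *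
                  ∫ u₂ in Ioi ((((k₁ / d * (g * e) * (g * d * (k₂ / e)) : ℕ) : ℝ) / qhat q ^ 2) / u₁),
                    Real.exp (-(u₁ + u₂)) / (1 - Real.exp (-(u₁ + u₂))) ^ 2 *
                    (Real.log (qhat q / ((g * d * (k₂ / e) : ℕ) : ℝ)) + Real.log u₂) ^ j)) -
          2 * (π ^ 2 / 6) ^ 2 * (qhat q / (Δ' ^ 2 * Real.log (qhat q) ^ 2)) * (Δ' ^ 2 * K₀ / (2 * (π ^ 2 / 6) ^ 2))| ≤
          C * qhat q * (Real.log (qhat q))⁻¹ ^ 3 :=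
    fun i j hij h00 ↦ orderTarget_of_genericRemainder i j (hR i j hij h00)
  choose! K₀ hK₀ using hT
  refine subDiag_of_selbergOrderAsymptotics hΔ1 hΔ (fun i j Δ' P ↦
    if Even (i + j) ∧ ¬(i = 0 ∧ j = 0) ∧ KMV2000.Admissible P ∧ 1 < Δ' ∧ Δ' ≤ Δ then
      Δ' ^ 2 * K₀ i j P Δ' / (2 * (π ^ 2 / 6) ^ 2)
    else KMV2000.secondMomentForm Δ' P 1 / 2) (fun Δ' P ↦ by simp) ?_
  intro i j hij h00 P hP Δ' h1 h2
  obtain ⟨C, q₀, hC⟩ := hK₀ i j hij h00 P hP Δ' h1 h2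
  refine ⟨C, q₀, fun q _ hq ↦ ?_⟩
  rw [if_pos ⟨hij, h00, hP, h1, h2⟩]
  exact hC q hq

end Summit.Parity.GeneralizedHardyLittlewood.Theorems.MomentsBeyondDiagonal.DiagKernel

end
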